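import Literature.AlgebraicGeometry.Resolution.ArithmeticalThreefoldsMonomials
import Literature.AlgebraicGeometry.Resolution.ArtinApproximationAffineLemmas
import Mathlib.RingTheory.AdicCompletion.LocalRing
import HarnessLib

/-!
# Cossart–Piltant 2019, proof of Prop. 4.8: the density step (512)

Topic: `Literature/AlgebraicGeometry/Resolution` (proofs only; no new notions, no new named
facts). Continuation of `ArithmeticalThreefoldsMonomials.lean` ((511):
`IsRsopPart.exists_prod_zpow_eq_units_mul_pow_of_comap`, and the consumer
`exists_adjoin_isRegularLocalRing_of_rsp_powers`). In the proof of Cossart–Piltant's descent from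
the formal completion (V. Cossart, O. Piltant, *Resolution of singularities of arithmetical
threefolds*, J. Algebra 529 (2019) 268–535 = arXiv:1412.0868, journal Prop. 4.8 = arXiv v1
Prop. 4.6, p. 53), after Lemma 4.7 (`√(h𝒪_{Ŷ,ŷ}) = √(m_Â 𝒪_{Ŷ,ŷ}) = (û₁ ⋯ û_r)`) and (511)
(`g_j = ∏ fᵢ^{m_{ij}} = δ̂_j û_j^a`, `j ≤ r`), the remaining parameters are reached from `A`:

> Since `A` is dense in `Â` for the `m_A`-adic topology, the right-hand side equality in (510)
> implies: there exists `g'_{r+1}, …, g'_d ∈ A` and positive integers `m_{ij}` … such that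
> `u'_j := g'_j ∏_{i=1}^r û_i^{-m_{ij}} ∈ 𝒪_{Ŷ,ŷ}` and `(û₁, …, û_r, u'_{r+1}, …, u'_d)` is a
> r.s.p. of `𝒪_{Ŷ,ŷ}`. Let now `g_j := g'_j{}^a ∏_{i=1}^r g_i^{-m_{ij}} = u'_j{}^a ∏ δ̂_i^{-m_{ij}}`
> (512).

This file PROVES the algebra of this step, in the vocabulary of the consumer
`exists_adjoin_isRegularLocalRing_of_rsp_powers` (a local ring `S` — in the source `𝒪_{Ŷ,ŷ}` —
mapping injectively to the formal-branch field `K̂₁ ⊇ K`):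

* `span_union_range_eq_maximalIdeal_of_perturb` — if `(u, x)` generates `𝔪_S`, so does
  `(u, x′)` for `x′_i = ε_i x_i + w_i`, `ε_i` units, `w_i ∈ (u)`;
* `exists_eq_prod_pow_mul_of_add_pow_mul` — an element
  `ε (∏ û_i^{m_i}) x + (û₁ ⋯ û_r)^N y` with `N > m_i` (`r ≥ 1`) is `(∏ û_i^{m_i}) · x′` with
  `x′ = ε x + w`, `w ∈ (u)` (the shape of an `m_A`-adic approximant when `m_A S ⊆ (û₁ ⋯ û_r)`);
* `exists_algebraMap_adicCompletion_eq_add_pow_mul` — density: if `m_A S ⊆ (q)` then every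
  element of `Â` is, in `S`, an element of `A` plus `q^N ·(…)`, for every `N`;
* `exists_rsp_powers_of_cp511_of_cp512` — **(512)**: from the output of (511) for
  `u = (û₁, …, û_r)` and elements `g'_i ∈ K` with `g'_i = (∏_j û_j^{m_{ij}}) · x′_i` in `K̂₁`,
  `(u, x′)` generating `𝔪_S`, the full datum of `exists_adjoin_isRegularLocalRing_of_rsp_powers`:
  generators `z = (u, x′)` of `𝔪_S` and, for EVERY `j`, `g_j ∈ K` with `g_j = c_j z_j^a`, `c_j ∈ Sˣ`;
* `exists_rsp_powers_of_cp511_of_shape` — the same from elements `b_i ∈ Â` whose images in `S`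
  are `unit · (∏_j û_j^{m_{ij}}) · x_i` and `m_A S ⊆ (û₁ ⋯ û_r)`, by density of `A` in `Â`.

What is NOT here: the existence of elements of `Â` (equivalently, by density, of `A`) of the
shape `unit · monomial(û) · parameter` — in the source this comes from the construction (510)
(the model is an isomorphism above `Spec Â_g`, `g ∣ h`, so its generators have denominators
dividing a power of `h`, i.e. monomials in the `ûᵢ` times units); it is the denominator clause
of the geometric head and is supplied by its prover.

## Sources

* V. Cossart, O. Piltant, J. Algebra 529 (2019) 268–535 = arXiv:1412.0868, proof of Prop. 4.8,
  (510)–(512) (arXiv v1: Prop. 4.6, p. 53). [CossartPiltant2019]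
* H. Matsumura, *Commutative Ring Theory*, Thm. 8.1 (`A/𝔪ⁿ = Â/𝔪ⁿÂ`). [Matsumura1987]
-/

noncomputable section

namespace Literature.AlgebraicGeometry.Resolution

universe u v w

open IsLocalRing

/-! ## Perturbing the complementary parameters -/

section Perturb

variable {S : Type u} [CommRing S] [IsLocalRing S]

/-- **Perturbing the complementary parameters.** If `𝔪_S` is generated by `u₁, …, u_r` and
`x₁, …, x_e`, then it is generated by the `u_j` and `x′_i := ε_i x_i + w_i` for units `ε_i` and
`w_i ∈ (u₁, …, u_r)` (in the source: `(û₁, …, û_r, u'_{r+1}, …, u'_d)` is again a r.s.p.).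
[cite: CossartPiltant2019, proof of Prop. 4.8, (512) (arXiv v1: Prop. 4.6, p. 53)] -/
theorem span_union_range_eq_maximalIdeal_of_perturb {r e : ℕ} (u : Fin r → S) (x : Fin e → S)
    (hux : Ideal.span (Set.range u ∪ Set.range x) = maximalIdeal S)
    (ε : Fin e → Sˣ) (w : Fin e → S) (hw : ∀ i, w i ∈ Ideal.span (Set.range u))
    (x' : Fin e → S) (hx' : ∀ i, x' i = ε i * x i + w i) :
    Ideal.span (Set.range u ∪ Set.range x') = maximalIdeal S := by
  have huM : ∀ j, u j ∈ maximalIdeal S := fun j =>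
    hux ▸ Ideal.subset_span (Or.inl ⟨j, rfl⟩)
  have hxM : ∀ i, x i ∈ maximalIdeal S := fun i =>
    hux ▸ Ideal.subset_span (Or.inr ⟨i, rfl⟩)
  have hspanu_le : Ideal.span (Set.range u) ≤ maximalIdeal S := by
    rw [Ideal.span_le]; rintro _ ⟨j, rfl⟩; exact huM j
  refine le_antisymm ?_ ?_
  · rw [Ideal.span_le]
    rintro _ (⟨j, rfl⟩ | ⟨i, rfl⟩)
    · exact huM j
    · rw [SetLike.mem_coe, hx' i]
      exact Ideal.add_mem _ (Ideal.mul_mem_left _ _ (hxM i)) (hspanu_le (hw i))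
  · -- `u_j` and `x_i = ε_i⁻¹ (x'_i - w_i)` lie in the new span
    have hu' : ∀ j, u j ∈ Ideal.span (Set.range u ∪ Set.range x') := fun j =>
      Ideal.subset_span (Or.inl ⟨j, rfl⟩)
    have hspanu : Ideal.span (Set.range u) ≤ Ideal.span (Set.range u ∪ Set.range x') :=
      Ideal.span_mono Set.subset_union_left
    have hx'' : ∀ i, x i ∈ Ideal.span (Set.range u ∪ Set.range x') := fun i => by
      have h1 : x i = ((ε i)⁻¹ : Sˣ) * (x' i - w i) := by
        rw [hx' i, add_sub_cancel_right, ← mul_assoc, Units.inv_mul, one_mul]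
      rw [h1]
      exact Ideal.mul_mem_left _ _ (Ideal.sub_mem _ (Ideal.subset_span (Or.inr ⟨i, rfl⟩))
        (hspanu (hw i)))
    rw [← hux, Ideal.span_le]
    rintro _ (⟨j, rfl⟩ | ⟨i, rfl⟩)
    · exact hu' j
    · exact hx'' i

omit [IsLocalRing S] in
/-- **The shape of an approximant.** For `r ≥ 1`, an element of the form
`ε (∏_j u_j^{m_j}) x + (∏_j u_j)^N y` with `m_j < N` for all `j` equals `(∏_j u_j^{m_j}) · x′`
with `x′ = ε x + w`, `w ∈ (u₁, …, u_r)` — the computation behind "there exists `g'_j ∈ A` … such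
that `u'_j := g'_j ∏ û_i^{-m_{ij}} ∈ 𝒪_{Ŷ,ŷ}`" once `g'_j` approximates an element of `Â` of the
shape `unit · monomial · parameter` modulo `m_A^N`, `m_A 𝒪_{Ŷ,ŷ} ⊆ (û₁ ⋯ û_r)`.
[cite: CossartPiltant2019, proof of Prop. 4.8, (512) (arXiv v1: Prop. 4.6, p. 53)] -/
theorem exists_eq_prod_pow_mul_of_add_pow_mul {r : ℕ} (hr : 0 < r) (u : Fin r → S)
    (m : Fin r → ℕ) (N : ℕ) (hN : ∀ j, m j < N) (ε x y b : S)
    (hb : b = ε * (∏ j, u j ^ m j) * x + (∏ j, u j) ^ N * y) :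
    ∃ w : S, w ∈ Ideal.span (Set.range u) ∧ b = (∏ j, u j ^ m j) * (ε * x + w) := by
  classical
  -- `(∏ u_j)^N = (∏ u_j^{m_j}) · ∏ u_j^{N - m_j}`, and the cofactor lies in `(u)`
  set c : S := ∏ j, u j ^ (N - m j) with hc
  have hsplit : (∏ j, u j) ^ N = (∏ j, u j ^ m j) * c := by
    rw [hc, ← Finset.prod_pow, ← Finset.prod_mul_distrib]
    refine Finset.prod_congr rfl fun j _ => ?_
    rw [← pow_add, Nat.add_sub_cancel' (hN j).le]
  have hcmem : c ∈ Ideal.span (Set.range u) := by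
    obtain ⟨j₀⟩ : Nonempty (Fin r) := ⟨⟨0, hr⟩⟩
    have hpos : 0 < N - m j₀ := Nat.sub_pos_of_lt (hN j₀)
    have hdvd : u j₀ ∣ c := by
      rw [hc]
      exact (dvd_pow_self (u j₀) hpos.ne').trans
        (Finset.dvd_prod_of_mem (fun j => u j ^ (N - m j)) (Finset.mem_univ j₀))
    obtain ⟨c', hc'⟩ := hdvd
    rw [hc']
    exact Ideal.mul_mem_right _ _ (Ideal.subset_span ⟨j₀, rfl⟩)
  refine ⟨c * y, Ideal.mul_mem_right _ _ hcmem, ?_⟩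
  rw [hb, hsplit]
  ring

end Perturb

/-! ## Density of `A` in `Â`, read in `S` -/

section Density

variable {A : Type u} [CommRing A] [IsLocalRing A] [IsNoetherianRing A]

/-- **Density of `A` in `Â`, read in an `Â`-algebra `S` with `m_A S ⊆ (q)`.** For every `x ∈ Â`
and every `N` there are `a ∈ A` and `y ∈ S` with `x = a + q^N y` in `S`: `x ≡ a mod m_A^N Â`
(`A/𝔪ⁿ = Â/𝔪ⁿÂ`) and `m_A^N S ⊆ (q^N)`. In the source `S = 𝒪_{Ŷ,ŷ}`, `q = û₁ ⋯ û_r`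
(Lemma 4.7: `√(m_Â 𝒪_{Ŷ,ŷ}) = (û₁ ⋯ û_r)`, so `m_A 𝒪_{Ŷ,ŷ} ⊆ (û₁ ⋯ û_r)`).
[cite: Matsumura1987, Thm. 8.1]
[cite: CossartPiltant2019, proof of Prop. 4.8, (510)–(512) (arXiv v1: Prop. 4.6, p. 53)] -/
theorem exists_algebraMap_adicCompletion_eq_add_pow_mul
    {S : Type v} [CommRing S] [Algebra (AdicCompletion (maximalIdeal A) A) S] [Algebra A S]
    [IsScalarTower A (AdicCompletion (maximalIdeal A) A) S]
    (q : S) (hq : (maximalIdeal A).map (algebraMap A S) ≤ Ideal.span {q})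
    (x : AdicCompletion (maximalIdeal A) A) (N : ℕ) :
    ∃ (a : A) (y : S), algebraMap _ S x = algebraMap A S a + q ^ N * y := by
  obtain ⟨a, ha⟩ := Ideal.Quotient.mk_surjective (AdicCompletion.evalₐ (maximalIdeal A) N x)
  have hmem : x - algebraMap A (AdicCompletion (maximalIdeal A) A) a ∈
      ((maximalIdeal A).map (algebraMap A (AdicCompletion (maximalIdeal A) A))) ^ N :=
    AdicCompletion.sub_of_mem_pow_map_of_evalₐ_eq (maximalIdeal A)
      (maximalIdeal A).fg_of_isNoetherianRing x a ha.symm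
  -- push to `S`
  have hmemS : algebraMap _ S (x - algebraMap A (AdicCompletion (maximalIdeal A) A) a) ∈
      (Ideal.span {q}) ^ N := by
    have h1 : algebraMap _ S (x - algebraMap A (AdicCompletion (maximalIdeal A) A) a) ∈
        (((maximalIdeal A).map (algebraMap A (AdicCompletion (maximalIdeal A) A))) ^ N).map
          (algebraMap (AdicCompletion (maximalIdeal A) A) S) :=
      Ideal.mem_map_of_mem _ hmem
    rw [Ideal.map_pow, Ideal.map_map, ← IsScalarTower.algebraMap_eq] at h1
    exact Ideal.pow_right_mono hq N h1
  rw [Ideal.span_singleton_pow, Ideal.mem_span_singleton'] at hmemS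
  obtain ⟨y, hy⟩ := hmemS
  refine ⟨a, y, ?_⟩
  rw [map_sub, ← IsScalarTower.algebraMap_apply] at hy
  rw [mul_comm, hy, add_sub_cancel]

end Density

/-! ## (512): completing the datum of (511) to all parameters -/

section CP512

variable {S : Type*} [CommRing S] [IsLocalRing S]
  {K₁ : Type*} [Field K₁] [Algebra S K₁]
  {K : Type*} [Field K] [Algebra K K₁]

/-- `range (Fin.append u x) = range u ∪ range x`. [folklore] -/
private theorem range_fin_append' {α : Type*} {r e : ℕ} (u : Fin r → α) (x : Fin e → α) :
    Set.range (Fin.append u x) = Set.range u ∪ Set.range x := by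
  ext a
  constructor
  · rintro ⟨i, rfl⟩
    induction i using Fin.addCases with
    | left j => exact Or.inl ⟨j, by simp⟩
    | right k => exact Or.inr ⟨k, by simp⟩
  · rintro (⟨j, rfl⟩ | ⟨k, rfl⟩)
    · exact ⟨Fin.castAdd e j, by simp⟩
    · exact ⟨Fin.natAdd r k, by simp⟩

/-- **Cossart–Piltant 2019, proof of Prop. 4.8, (512).** Let `S` be a local ring mapping
injectively into a field `K̂₁ ⊇ K`, with `𝔪_S` generated by `u₁, …, u_r` (nonzero) and
`x′₁, …, x′_e`. Suppose given the output of (511) — an exponent `a` (in the source `a > 0`), units `δ_j ∈ Sˣ` and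
`g_j ∈ K` with `g_j = δ_j u_j^a` in `K̂₁` — and, for each `i`, an element `g'_i ∈ K` and exponents
`m_{ij}` with `g'_i = (∏_j u_j^{m_{ij}}) x′_i` in `K̂₁` ("`u'_j := g'_j ∏ û_i^{-m_{ij}}`"). Then with
`G_i := g'_i{}^a ∏_j g_j^{-m_{ij}} ∈ K` one has `G_i = (∏_j δ_j^{-m_{ij}}) x′_i{}^a` in `K̂₁`, so the
generators `z = (u, x′)` of `𝔪_S` come, for EVERY index, with an element of `K` equal to a unit
times their `a`-th power — the input of `exists_adjoin_isRegularLocalRing_of_rsp_powers`.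
[cite: CossartPiltant2019, proof of Prop. 4.8, (511)–(512) (arXiv v1: Prop. 4.6, p. 53)] -/
theorem exists_rsp_powers_of_cp511_of_cp512 (hSK₁ : Function.Injective (algebraMap S K₁))
    {r e : ℕ} (u : Fin r → S) (hu0 : ∀ j, u j ≠ 0) (x' : Fin e → S)
    (hspan : Ideal.span (Set.range u ∪ Set.range x') = maximalIdeal S)
    (a : ℕ) (δ : Fin r → Sˣ) (g : Fin r → K)
    (hg : ∀ j, algebraMap K K₁ (g j) = algebraMap S K₁ (δ j * u j ^ a))
    (g' : Fin e → K) (m : Fin e → Fin r → ℕ)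
    (hg' : ∀ i, algebraMap K K₁ (g' i) = algebraMap S K₁ ((∏ j, u j ^ m i j) * x' i)) :
    ∃ (z : Fin (r + e) → S), Ideal.span (Set.range z) = maximalIdeal S ∧
      (∀ j : Fin r, z (Fin.castAdd e j) = u j) ∧ (∀ i : Fin e, z (Fin.natAdd r i) = x' i) ∧
      ∃ (c : Fin (r + e) → Sˣ) (G : Fin (r + e) → K),
        ∀ j, algebraMap K K₁ (G j) = algebraMap S K₁ (c j * z j ^ a) := by
  classical
  set σ := algebraMap S K₁ with hσ
  have hσu : ∀ j, σ (u j) ≠ 0 := fun j => (map_ne_zero_iff σ hSK₁).mpr (hu0 j)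
  have hσδ : ∀ j, σ (δ j : S) ≠ 0 := fun j =>
    (map_ne_zero_iff σ hSK₁).mpr (δ j).ne_zero
  -- the elements for the complementary parameters
  let c' : Fin e → Sˣ := fun i => ∏ j, (δ j)⁻¹ ^ m i j
  let G' : Fin e → K := fun i => g' i ^ a * ∏ j, (g j)⁻¹ ^ m i j
  have hG' : ∀ i, algebraMap K K₁ (G' i) = σ ((c' i : S) * x' i ^ a) := by
    intro i
    have hL : algebraMap K K₁ (G' i) =
        (σ (∏ j, u j ^ m i j) * σ (x' i)) ^ a *
          ∏ j, (σ (δ j : S) * σ (u j) ^ a)⁻¹ ^ m i j := by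
      simp only [G', map_mul, map_pow, map_prod, map_inv₀, hg', hg]
    have hR : σ ((c' i : S) * x' i ^ a) = (∏ j, (σ (δ j : S))⁻¹ ^ m i j) * σ (x' i) ^ a := by
      rw [map_mul, map_pow, Units.coe_prod, map_prod]
      congr 1
      refine Finset.prod_congr rfl fun j _ => ?_
      rw [Units.val_pow_eq_pow_val, map_pow, map_units_inv]
    rw [hL, hR]
    have hkey : σ (∏ j, u j ^ m i j) ^ a * ∏ j, (σ (δ j : S) * σ (u j) ^ a)⁻¹ ^ m i j =
        ∏ j, (σ (δ j : S))⁻¹ ^ m i j := by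
      rw [map_prod, ← Finset.prod_pow, ← Finset.prod_mul_distrib]
      refine Finset.prod_congr rfl fun j _ => ?_
      rw [map_pow, ← pow_mul, mul_inv, mul_pow, inv_pow, inv_pow, ← pow_mul,
        mul_comm (m i j) a]
      have hne : σ (u j) ^ (a * m i j) ≠ 0 := pow_ne_zero _ (hσu j)
      field_simp
    calc (σ (∏ j, u j ^ m i j) * σ (x' i)) ^ a * ∏ j, (σ (δ j : S) * σ (u j) ^ a)⁻¹ ^ m i j
        = σ (x' i) ^ a * (σ (∏ j, u j ^ m i j) ^ a *
            ∏ j, (σ (δ j : S) * σ (u j) ^ a)⁻¹ ^ m i j) := by ring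
      _ = (∏ j, (σ (δ j : S))⁻¹ ^ m i j) * σ (x' i) ^ a := by rw [hkey, mul_comm]
  -- assemble `z = (u, x')`
  refine ⟨Fin.append u x', ?_, fun j => Fin.append_left u x' j,
    fun i => Fin.append_right u x' i, Fin.append δ c', Fin.append g G', ?_⟩
  · rw [range_fin_append', hspan]
  · intro j
    induction j using Fin.addCases with
    | left j => simp only [Fin.append_left, hg]
    | right i => simp only [Fin.append_right, hG']

end CP512

/-! ## (512) from elements of `Â` of the shape `unit · monomial · parameter` -/

section CP512Shape

variable {A : Type u} [CommRing A] [IsLocalRing A] [IsNoetherianRing A]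
  {K : Type u} [Field K] [Algebra A K]
  {S : Type u} [CommRing S] [IsLocalRing S] [Algebra (AdicCompletion (maximalIdeal A) A) S]
  [Algebra A S] [IsScalarTower A (AdicCompletion (maximalIdeal A) A) S]
  {K₁ : Type u} [Field K₁] [Algebra S K₁] [Algebra A K₁] [IsScalarTower A S K₁]
  [Algebra K K₁] [IsScalarTower A K K₁]

/-- **Cossart–Piltant 2019, proof of Prop. 4.8: (512) by density.** Let `(A, 𝔪)` be Noetherian
local with fraction field `K`, `S` a local `Â`-algebra (in the source `𝒪_{Ŷ,ŷ}`) mapping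
injectively to a field `K̂₁ ⊇ K` compatibly with `A → K → K̂₁`, with `𝔪_S` generated by nonzero
`u₁, …, u_r` (`r ≥ 1`) and `x₁, …, x_e`, and `𝔪_A S ⊆ (u₁ ⋯ u_r)` (Lemma 4.7:
`√(m_Â 𝒪_{Ŷ,ŷ}) = (û₁ ⋯ û_r)`). Suppose given the output of (511) for `u` (`g_j ∈ K`,
`g_j = δ_j u_j^a`) and, for each complementary parameter `x_i`, an element `b_i ∈ Â` whose image
in `S` is `ε_i (∏_j u_j^{m_{ij}}) x_i` with `ε_i` a unit (in the source: from (510), the model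
being an isomorphism above `Spec Â_g`). Then — "since `A` is dense in `Â` for the `m_A`-adic
topology" — there are `g'_i ∈ A` with `g'_i = (∏_j u_j^{m_{ij}}) x′_i`, `(u, x′)` again generating
`𝔪_S` (`exists_algebraMap_adicCompletion_eq_add_pow_mul`, `exists_eq_prod_pow_mul_of_add_pow_mul`,
`span_union_range_eq_maximalIdeal_of_perturb`), and (512) (`exists_rsp_powers_of_cp511_of_cp512`)
yields generators `z = (u, x′)` of `𝔪_S` with, for every index, an element of `K` equal in `K̂₁`
to a unit times `z_j^a` — the input of `exists_adjoin_isRegularLocalRing_of_rsp_powers`.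
[cite: CossartPiltant2019, proof of Prop. 4.8, (510)–(512) (arXiv v1: Prop. 4.6, p. 53)]
[cite: Matsumura1987, Thm. 8.1] -/
theorem exists_rsp_powers_of_cp511_of_shape (hSK₁ : Function.Injective (algebraMap S K₁))
    {r e : ℕ} (hr : 0 < r) (u : Fin r → S) (hu0 : ∀ j, u j ≠ 0) (x : Fin e → S)
    (hspan : Ideal.span (Set.range u ∪ Set.range x) = maximalIdeal S)
    (hq : (maximalIdeal A).map (algebraMap A S) ≤ Ideal.span {∏ j, u j})
    (a : ℕ) (δ : Fin r → Sˣ) (g : Fin r → K)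
    (hg : ∀ j, algebraMap K K₁ (g j) = algebraMap S K₁ (δ j * u j ^ a))
    (b : Fin e → AdicCompletion (maximalIdeal A) A) (ε : Fin e → Sˣ) (m : Fin e → Fin r → ℕ)
    (hb : ∀ i, algebraMap _ S (b i) = ε i * (∏ j, u j ^ m i j) * x i) :
    ∃ (z : Fin (r + e) → S), Ideal.span (Set.range z) = maximalIdeal S ∧
      (∀ j : Fin r, z (Fin.castAdd e j) = u j) ∧
      ∃ (c : Fin (r + e) → Sˣ) (G : Fin (r + e) → K),
        ∀ j, algebraMap K K₁ (G j) = algebraMap S K₁ (c j * z j ^ a) := by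
  classical
  -- a common modulus `N > m i j`
  set N : ℕ := (Finset.univ.sup fun i => Finset.univ.sup (m i)) + 1 with hN
  have hmN : ∀ i j, m i j < N := fun i j => by
    have h1 : m i j ≤ Finset.univ.sup (m i) := Finset.le_sup (f := m i) (Finset.mem_univ j)
    have h2 : Finset.univ.sup (m i) ≤ Finset.univ.sup fun i => Finset.univ.sup (m i) :=
      Finset.le_sup (f := fun i => Finset.univ.sup (m i)) (Finset.mem_univ i)
    omega
  -- density: `b i = a i + (∏ u)^N y i` in `S` with `a i ∈ A`
  choose a' y hay using fun i =>
    exists_algebraMap_adicCompletion_eq_add_pow_mul (A := A) (∏ j, u j) hq (b i) N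
  -- the shape of the approximants
  have hshape : ∀ i, ∃ w : S, w ∈ Ideal.span (Set.range u) ∧
      algebraMap A S (a' i) = (∏ j, u j ^ m i j) * (ε i * x i + w) := fun i =>
    exists_eq_prod_pow_mul_of_add_pow_mul hr u (m i) N (hmN i) (ε i : S) (x i) (-y i)
      (algebraMap A S (a' i)) (by rw [← hb i, hay i]; ring)
  choose w hw haw using hshape
  set x' : Fin e → S := fun i => ε i * x i + w i with hx'
  have hspan' : Ideal.span (Set.range u ∪ Set.range x') = maximalIdeal S :=
    span_union_range_eq_maximalIdeal_of_perturb u x hspan ε w hw x' fun i => rfl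
  -- the `g'_i ∈ A ⊆ K`
  have hg' : ∀ i, algebraMap K K₁ (algebraMap A K (a' i)) =
      algebraMap S K₁ ((∏ j, u j ^ m i j) * x' i) := fun i => by
    rw [← IsScalarTower.algebraMap_apply, IsScalarTower.algebraMap_apply A S K₁, haw i]
  obtain ⟨z, hz, hzu, -, c, G, hG⟩ :=
    exists_rsp_powers_of_cp511_of_cp512 hSK₁ u hu0 x' hspan' a δ g hg
      (fun i => algebraMap A K (a' i)) m hg'
  exact ⟨z, hz, hzu, c, G, hG⟩

end CP512Shape

end Literature.AlgebraicGeometry.Resolution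

end
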